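import Summits.QuantumFields.BalabanUV.Beta.AxialDressingRooted

/-!
# The ROOTED axial dressing `Πᵀ_ρ` — part 2: leg dressings, bond slot, translation sockets and the functor `dressAt`

HONEST FRAMING (cell charter, verbatim): «discharging BetaPertH makes Balaban's UV stability UNCONDITIONAL — a real
constructive-QFT result; it is NOT the continuum limit and NOT the Clay problem.»  DERIVED cell leaf (pub-balaban β sub-cell,
lane an2, work-order (P7′)); no statement of Bałaban's papers is typed here, no `[cite:]` tag, no `Prop` fact; it instantiates
no binder of the β-function wall by itself.  NOT `BetaPertH`; NOT continuum; NOT Clay.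

## What is here (decl-by-decl twin of `AxialDressing` §1, §3, §4, §4b, §5 for the ROOTED transpose `Πᵀ_ρ = coProjAt ρ N` of part 1)

* §4 `legCo₁At ρ N`, `legCo₂At ρ N`, `dressKAt ρ N` + computation rules;
* §5 `biLoc_legCo₁At` / `biLoc_legCo₂At` / `biLoc_dressKAt` (constant `cK d N δ = cW·exp(δ(d+1)N)` per leg), in-block roots;
* §6 the bond slot `coProjAtK ρ N S` (entrywise `Πᵀ_ρ`), `locStencil_coProjAtK` (constant `cK'`), `locStencil_dressKAt`;
* §7 `legCo₁At_shiftK` / `legCo₂At_shiftK` / `dressKAt_shiftK` and the SOCKETS `dressAtS_translate` / `dressAtW_translate` —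
  the shapes of `AxialDressing.dressS_translate` / `dressW_translate` VERBATIM (so `JsBal…_S/W_translate` re-prove by the same
  two lines for the rooted families);
* §8 `dressAt (hr : r ∈ box (d+1) N) : JetData d N → JetData d N` (fields `S W Cs Cw δ δ_pos loc loc₂`), `dressAt_S/_W/_δ/_Cs/_Cw`
  (`rfl`), and the centred instance `dressCtr` (`r = ctrOff (d+1) N`).

NOT here: the read-out twin `TbalOf_dressAt = hessKer (axDressKAt ρ …) (axVertexOfKAt ρ …) W` of `AxialDressing` §6–§10
(work-order ρ1b; not needed by the wall literal), the faithfulness bridge at `ρ = 0` (part 3), reflection laws (an5's lane).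

Provenance: b2b-balaban β sub-cell, unit beta-an2 gen 11, 2026-08-19 (v1); over part 1 and, BY NAME, `Beta.AxialDressing`
(`exp_recenter_le`), `Beta.ExpKernelCalculus`, `Beta.OneStepResolventKernel` (`JetData`, `LocStencil`), an1's
`Beta.AveragingContoursRooted` (`ctrOff_mem_box`).
-/

open Finset
open scoped BigOperators
open Literature.MathematicalPhysics.QuantumFieldTheory
open Literature.MathematicalPhysics.QuantumFieldTheory.Balaban1983to89
open Literature.MathematicalPhysics.QuantumFieldTheory.Balaban1983to89.Beta
open B12Sec2to5 (l1 l1_nonneg)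
open ExpKernelCalculus (BiLoc l1_sub_triangle l1_sub_symm)
open AffineAveraging (Form0 Form1 unitVec unitVec_apply box toSite)
open AveragingContoursRooted (treeGaugeAt ctrOff ctrOff_mem_box)
open AxialDressing (exp_recenter_le)
open OneStepResolventKernel (Fib LocStencil JetData)

namespace Summit.QuantumFields.BalabanUV.Beta.AxialDressingRooted

variable {d : ℕ}

/-! ## §4 The rooted leg dressings `legCo₁At`, `legCo₂At`, `dressKAt` -/

section Legs

/-- [folklore] `Πᵀ_ρ` on the FIRST leg of a kernel table (`inl` components; multiplier legs untouched). -/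
noncomputable def legCo₁At (ρ : Fin (d + 1) → ℤ) (N : ℕ) (K : ExpKernelCalculus.MKer (d + 1) (Fib d)) :
    ExpKernelCalculus.MKer (d + 1) (Fib d) :=
  fun x y a b =>
    match a with
    | Sum.inl α => coProjAt ρ N (fun α' x' => K x' y (Sum.inl α') b) α x
    | Sum.inr _ => K x y a b

/-- [folklore] `Πᵀ_ρ` on the SECOND leg of a kernel table. -/
noncomputable def legCo₂At (ρ : Fin (d + 1) → ℤ) (N : ℕ) (K : ExpKernelCalculus.MKer (d + 1) (Fib d)) :
    ExpKernelCalculus.MKer (d + 1) (Fib d) :=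
  fun x y a b =>
    match b with
    | Sum.inl β => coProjAt ρ N (fun β' y' => K x y' a (Sum.inl β')) β y
    | Sum.inr _ => K x y a b

/-- [folklore] **THE ROOTED KERNEL DRESSING** `K ↦ Πᵀ_ρ-on-leg-2 (Πᵀ_ρ-on-leg-1 K)`. -/
noncomputable def dressKAt (ρ : Fin (d + 1) → ℤ) (N : ℕ) (K : ExpKernelCalculus.MKer (d + 1) (Fib d)) :
    ExpKernelCalculus.MKer (d + 1) (Fib d) :=
  legCo₂At ρ N (legCo₁At ρ N K)

/-- [folklore] Computation rule, first leg, field component. -/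
theorem legCo₁At_inl (ρ : Fin (d + 1) → ℤ) (N : ℕ) (K : ExpKernelCalculus.MKer (d + 1) (Fib d))
    (x y : Fin (d + 1) → ℤ) (α : Fin (d + 1)) (b : Fib d) :
    legCo₁At ρ N K x y (Sum.inl α) b = coProjAt ρ N (fun α' x' => K x' y (Sum.inl α') b) α x := rfl

/-- [folklore] Computation rule, first leg, multiplier component. -/
theorem legCo₁At_inr (ρ : Fin (d + 1) → ℤ) (N : ℕ) (K : ExpKernelCalculus.MKer (d + 1) (Fib d))
    (x y : Fin (d + 1) → ℤ) (m : Fin (d + 1)) (b : Fib d) :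
    legCo₁At ρ N K x y (Sum.inr m) b = K x y (Sum.inr m) b := rfl

/-- [folklore] Computation rule, second leg, field component. -/
theorem legCo₂At_inl (ρ : Fin (d + 1) → ℤ) (N : ℕ) (K : ExpKernelCalculus.MKer (d + 1) (Fib d))
    (x y : Fin (d + 1) → ℤ) (a : Fib d) (β : Fin (d + 1)) :
    legCo₂At ρ N K x y a (Sum.inl β) = coProjAt ρ N (fun β' y' => K x y' a (Sum.inl β')) β y := rfl

/-- [folklore] Computation rule, second leg, multiplier component. -/
theorem legCo₂At_inr (ρ : Fin (d + 1) → ℤ) (N : ℕ) (K : ExpKernelCalculus.MKer (d + 1) (Fib d))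
    (x y : Fin (d + 1) → ℤ) (a : Fib d) (m : Fin (d + 1)) :
    legCo₂At ρ N K x y a (Sum.inr m) = K x y a (Sum.inr m) := rfl

/-- [folklore] `dressKAt` unfolds to the two leg dressings. -/
theorem dressKAt_eq (ρ : Fin (d + 1) → ℤ) (N : ℕ) (K : ExpKernelCalculus.MKer (d + 1) (Fib d)) :
    dressKAt ρ N K = legCo₂At ρ N (legCo₁At ρ N K) := rfl

end Legs

/-! ## §5 Localisation is preserved by the rooted leg dressings (in-block roots) -/

section LegBounds

/-- [folklore] The rooted dressing constant of one leg: `cK := cW (d+1) N · exp(δ(d+1)N)`. -/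
noncomputable def cK (d N : ℕ) (δ : ℝ) : ℝ := cW (d + 1) N * Real.exp (δ * (((d : ℝ) + 1) * N))

/-- [folklore] `0 ≤ cK`. -/
theorem cK_nonneg (d N : ℕ) (δ : ℝ) : 0 ≤ cK d N δ := by
  unfold cK
  exact mul_nonneg (cW_nonneg _ _) (Real.exp_pos _).le

/-- [folklore] `1 ≤ cK` (`1 ≤ N`, `0 ≤ δ`): the window contains the bond itself. -/
theorem one_le_cK (d : ℕ) {N : ℕ} (hN : 1 ≤ N) {δ : ℝ} (hδ : 0 ≤ δ) : 1 ≤ cK d N δ := by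
  have h1 : (1 : ℝ) ≤ (((2 * N + 1) ^ (d + 1) : ℕ) : ℝ) := by
    exact_mod_cast Nat.one_le_pow _ _ (by omega)
  have h2 : (1 : ℝ) ≤ ((d + 1 : ℕ) : ℝ) * (1 + 2 * (((d + 1 : ℕ) : ℝ) * N)) := by
    have a : (1 : ℝ) ≤ ((d + 1 : ℕ) : ℝ) := by exact_mod_cast Nat.succ_le_succ (Nat.zero_le d)
    have b : (1 : ℝ) ≤ 1 + 2 * (((d + 1 : ℕ) : ℝ) * N) := by
      have : (0 : ℝ) ≤ 2 * (((d + 1 : ℕ) : ℝ) * N) := by positivity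
      linarith
    nlinarith
  have h12 : (1 : ℝ) ≤ cW (d + 1) N := by
    unfold cW
    calc (1 : ℝ) = 1 * 1 := (mul_one 1).symm
      _ ≤ _ := mul_le_mul h1 h2 zero_le_one (zero_le_one.trans h1)
  have h3 : (1 : ℝ) ≤ Real.exp (δ * (((d : ℝ) + 1) * N)) := Real.one_le_exp (by positivity)
  unfold cK
  calc (1 : ℝ) = 1 * 1 := (mul_one 1).symm
    _ ≤ cW (d + 1) N * Real.exp (δ * (((d : ℝ) + 1) * N)) := mul_le_mul h12 h3 zero_le_one (zero_le_one.trans h12)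

/-- [folklore] A window point `x + v` is within `ℓ¹`-distance `(d+1)·N` of `x`. -/
theorem l1_sub_window_le {N : ℕ} (x : Fin (d + 1) → ℤ) {v : Fin (d + 1) → ℤ} (hv : v ∈ cube (d + 1) N) :
    l1 (x - (x + v)) ≤ ((d : ℝ) + 1) * N := by
  rw [sub_add_cancel_left, l1_neg]
  have h := l1_le_of_mem_cube hv
  push_cast at h
  exact h

/-- [folklore] **FIRST-LEG ROOTED DRESSING PRESERVES BI-LOCALISATION:** `BiLoc K p q C δ ⇒ BiLoc (legCo₁At ρ N K) p q (cK·C) δ`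
(in-block root `ρ = toSite r`, `1 ≤ N`, `0 ≤ δ`). -/
theorem biLoc_legCo₁At {N : ℕ} (hN : 1 ≤ N) {r : Fin (d + 1) → ℕ} (hr : r ∈ box (d + 1) N)
    {K : ExpKernelCalculus.MKer (d + 1) (Fib d)} {p q : Fin (d + 1) → ℤ} {C δ : ℝ}
    (h : BiLoc K p q C δ) (hδ : 0 ≤ δ) : BiLoc (legCo₁At (toSite r) N K) p q (cK d N δ * C) δ := by
  have hC : 0 ≤ C := h.nonneg (Sum.inl 0)
  intro x y a b
  cases a with
  | inr m =>
    rw [legCo₁At_inr]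
    calc |K x y (Sum.inr m) b| ≤ C * Real.exp (-δ * (l1 (x - p) + l1 (y - q))) := h x y _ b
      _ ≤ cK d N δ * C * Real.exp (-δ * (l1 (x - p) + l1 (y - q))) := by
          have h1 := one_le_cK d hN hδ
          have h2 : 0 ≤ C * Real.exp (-δ * (l1 (x - p) + l1 (y - q))) := by positivity
          nlinarith
  | inl α =>
    rw [legCo₁At_inl]
    have hM : ∀ (κ : Fin (d + 1)) (v : Fin (d + 1) → ℤ), v ∈ cube (d + 1) N →
        |K (x + v) y (Sum.inl κ) b| ≤ C * Real.exp (δ * (((d : ℝ) + 1) * N)) * Real.exp (-δ * (l1 (x - p) + l1 (y - q))) :=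
      fun κ v hv => (h (x + v) y _ b).trans (exp_recenter_le (l1_sub_window_le x hv) hC hδ)
    calc |coProjAt (toSite r) N (fun α' x' => K x' y (Sum.inl α') b) α x|
        ≤ cW (d + 1) N * (C * Real.exp (δ * (((d : ℝ) + 1) * N)) * Real.exp (-δ * (l1 (x - p) + l1 (y - q)))) :=
          abs_coProjAt_le hN hr _ α x hM
      _ = cK d N δ * C * Real.exp (-δ * (l1 (x - p) + l1 (y - q))) := by
          unfold cK
          ring

/-- [folklore] **SECOND-LEG ROOTED DRESSING PRESERVES BI-LOCALISATION.** -/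
theorem biLoc_legCo₂At {N : ℕ} (hN : 1 ≤ N) {r : Fin (d + 1) → ℕ} (hr : r ∈ box (d + 1) N)
    {K : ExpKernelCalculus.MKer (d + 1) (Fib d)} {p q : Fin (d + 1) → ℤ} {C δ : ℝ}
    (h : BiLoc K p q C δ) (hδ : 0 ≤ δ) : BiLoc (legCo₂At (toSite r) N K) p q (cK d N δ * C) δ := by
  have hC : 0 ≤ C := h.nonneg (Sum.inl 0)
  intro x y a b
  cases b with
  | inr m =>
    rw [legCo₂At_inr]
    calc |K x y a (Sum.inr m)| ≤ C * Real.exp (-δ * (l1 (x - p) + l1 (y - q))) := h x y a _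
      _ ≤ cK d N δ * C * Real.exp (-δ * (l1 (x - p) + l1 (y - q))) := by
          have h1 := one_le_cK d hN hδ
          have h2 : 0 ≤ C * Real.exp (-δ * (l1 (x - p) + l1 (y - q))) := by positivity
          nlinarith
  | inl β =>
    rw [legCo₂At_inl]
    have hM : ∀ (κ : Fin (d + 1)) (v : Fin (d + 1) → ℤ), v ∈ cube (d + 1) N →
        |K x (y + v) a (Sum.inl κ)| ≤ C * Real.exp (δ * (((d : ℝ) + 1) * N)) * Real.exp (-δ * (l1 (y - q) + l1 (x - p))) := by
      intro κ v hv
      have h1 := h x (y + v) a (Sum.inl κ)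
      rw [add_comm (l1 (x - p)) (l1 (y + v - q))] at h1
      exact h1.trans (exp_recenter_le (l1_sub_window_le y hv) hC hδ)
    calc |coProjAt (toSite r) N (fun β' y' => K x y' a (Sum.inl β')) β y|
        ≤ cW (d + 1) N * (C * Real.exp (δ * (((d : ℝ) + 1) * N)) * Real.exp (-δ * (l1 (y - q) + l1 (x - p)))) :=
          abs_coProjAt_le hN hr _ β y hM
      _ = cK d N δ * C * Real.exp (-δ * (l1 (x - p) + l1 (y - q))) := by
          unfold cK
          rw [add_comm (l1 (y - q))]
          ring

/-- [folklore] **THE ROOTED KERNEL DRESSING PRESERVES BI-LOCALISATION:** `BiLoc K p q C δ ⇒ BiLoc (dressKAt ρ N K) p q (cK²·C) δ`. -/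
theorem biLoc_dressKAt {N : ℕ} (hN : 1 ≤ N) {r : Fin (d + 1) → ℕ} (hr : r ∈ box (d + 1) N)
    {K : ExpKernelCalculus.MKer (d + 1) (Fib d)} {p q : Fin (d + 1) → ℤ} {C δ : ℝ}
    (h : BiLoc K p q C δ) (hδ : 0 ≤ δ) : BiLoc (dressKAt (toSite r) N K) p q (cK d N δ * (cK d N δ * C)) δ :=
  biLoc_legCo₂At hN hr (biLoc_legCo₁At hN hr h hδ) hδ

end LegBounds

/-! ## §6 The bond slot: `Πᵀ_ρ` on the `MKer`-valued stencil family -/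

section BondSlot

/-- [folklore] `Πᵀ_ρ` on an `MKer`-valued bond family, entrywise: `(Πᵀ_ρ S) κ u x y a b := Πᵀ_ρ (S · · x y a b) κ u`. -/
noncomputable def coProjAtK (ρ : Fin (d + 1) → ℤ) (N : ℕ)
    (S : Fin (d + 1) → (Fin (d + 1) → ℤ) → ExpKernelCalculus.MKer (d + 1) (Fib d)) :
    Fin (d + 1) → (Fin (d + 1) → ℤ) → ExpKernelCalculus.MKer (d + 1) (Fib d) :=
  fun κ u x y a b => coProjAt ρ N (fun κ' u' => S κ' u' x y a b) κ u

/-- [folklore] Evaluation at a kernel entry commutes with `Πᵀ_ρ` (by definition). -/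
theorem coProjAtK_eval (ρ : Fin (d + 1) → ℤ) (N : ℕ)
    (S : Fin (d + 1) → (Fin (d + 1) → ℤ) → ExpKernelCalculus.MKer (d + 1) (Fib d))
    (κ : Fin (d + 1)) (u x y : Fin (d + 1) → ℤ) (a b : Fib d) :
    coProjAtK ρ N S κ u x y a b = coProjAt ρ N (fun κ' u' => S κ' u' x y a b) κ u := rfl

/-- [folklore] The rooted dressing constant of the bond slot: `cK' := cW (d+1) N · exp(2δ(d+1)N)`. -/
noncomputable def cK' (d N : ℕ) (δ : ℝ) : ℝ := cW (d + 1) N * Real.exp (2 * δ * (((d : ℝ) + 1) * N))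

/-- [folklore] `0 ≤ cK'`. -/
theorem cK'_nonneg (d N : ℕ) (δ : ℝ) : 0 ≤ cK' d N δ := by
  unfold cK'
  exact mul_nonneg (cW_nonneg _ _) (Real.exp_pos _).le

/-- [folklore] **THE ROOTED BOND-SLOT DRESSING PRESERVES `LocStencil`:** `LocStencil S Cs δ ⇒ LocStencil (Πᵀ_ρ S) (cK'·Cs) δ`
(in-block root, `1 ≤ N`, `0 ≤ δ`). -/
theorem locStencil_coProjAtK {N : ℕ} (hN : 1 ≤ N) {r : Fin (d + 1) → ℕ} (hr : r ∈ box (d + 1) N)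
    {S : Fin (d + 1) → (Fin (d + 1) → ℤ) → ExpKernelCalculus.MKer (d + 1) (Fib d)} {Cs δ : ℝ}
    (hS : LocStencil S Cs δ) (hδ : 0 ≤ δ) : LocStencil (coProjAtK (toSite r) N S) (cK' d N δ * Cs) δ := by
  have hC : 0 ≤ Cs := (hS 0 0).nonneg (Sum.inl 0)
  intro κ u x y a b
  rw [coProjAtK_eval]
  have hM : ∀ (κ' : Fin (d + 1)) (v : Fin (d + 1) → ℤ), v ∈ cube (d + 1) N →
      |S κ' (u + v) x y a b| ≤ Cs * Real.exp (2 * δ * (((d : ℝ) + 1) * N)) * Real.exp (-δ * (l1 (x - u) + l1 (y - u))) := by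
    intro κ' v hv
    have hr' : l1 ((u + v) - u) ≤ ((d : ℝ) + 1) * N := by
      rw [add_sub_cancel_left]
      have h := l1_le_of_mem_cube hv
      push_cast at h
      exact h
    have tx : l1 (x - u) ≤ l1 (x - (u + v)) + l1 ((u + v) - u) := l1_sub_triangle x (u + v) u
    have ty : l1 (y - u) ≤ l1 (y - (u + v)) + l1 ((u + v) - u) := l1_sub_triangle y (u + v) u
    calc |S κ' (u + v) x y a b| ≤ Cs * Real.exp (-δ * (l1 (x - (u + v)) + l1 (y - (u + v)))) := hS κ' (u + v) x y a b
      _ ≤ Cs * (Real.exp (2 * δ * (((d : ℝ) + 1) * N)) * Real.exp (-δ * (l1 (x - u) + l1 (y - u)))) := by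
          refine mul_le_mul_of_nonneg_left ?_ hC
          rw [← Real.exp_add]
          exact Real.exp_le_exp.2 (by nlinarith)
      _ = Cs * Real.exp (2 * δ * (((d : ℝ) + 1) * N)) * Real.exp (-δ * (l1 (x - u) + l1 (y - u))) := by ring
  calc |coProjAt (toSite r) N (fun κ' u' => S κ' u' x y a b) κ u|
      ≤ cW (d + 1) N * (Cs * Real.exp (2 * δ * (((d : ℝ) + 1) * N)) * Real.exp (-δ * (l1 (x - u) + l1 (y - u)))) :=
        abs_coProjAt_le hN hr _ κ u hM
    _ = cK' d N δ * Cs * Real.exp (-δ * (l1 (x - u) + l1 (y - u))) := by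
        unfold cK'
        ring

/-- [folklore] `LocStencil` survives the full rooted kernel dressing of every stencil value as well. -/
theorem locStencil_dressKAt {N : ℕ} (hN : 1 ≤ N) {r : Fin (d + 1) → ℕ} (hr : r ∈ box (d + 1) N)
    {S : Fin (d + 1) → (Fin (d + 1) → ℤ) → ExpKernelCalculus.MKer (d + 1) (Fib d)} {Cs δ : ℝ}
    (hS : LocStencil S Cs δ) (hδ : 0 ≤ δ) :
    LocStencil (fun κ u => dressKAt (toSite r) N (S κ u)) (cK d N δ * (cK d N δ * Cs)) δ :=
  fun κ u => biLoc_dressKAt hN hr (hS κ u) hδ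

end BondSlot

/-! ## §7 Coarse-translation covariance of the rooted dressings; the `covS` / `covW` sockets -/

section ShiftK

/-- [folklore] `Πᵀ_ρ` on an `MKer`-valued bond family commutes with a simultaneous shift of the kernel arguments. -/
theorem coProjAtK_shiftK (ρ : Fin (d + 1) → ℤ) (N : ℕ)
    (S : Fin (d + 1) → (Fin (d + 1) → ℤ) → ExpKernelCalculus.MKer (d + 1) (Fib d))
    (v : Fin (d + 1) → ℤ) (κ : Fin (d + 1)) (u : Fin (d + 1) → ℤ) :
    coProjAtK ρ N (fun κ' u' => ExpKernelCalculus.shiftK v (S κ' u')) κ u = ExpKernelCalculus.shiftK v (coProjAtK ρ N S κ u) :=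
  rfl

/-- [folklore] The first-leg rooted dressing commutes with simultaneous COARSE shifts of the kernel arguments. -/
theorem legCo₁At_shiftK (ρ : Fin (d + 1) → ℤ) {N : ℕ} (hN : 1 ≤ N) (K : ExpKernelCalculus.MKer (d + 1) (Fib d))
    (t : Fin (d + 1) → ℤ) :
    legCo₁At ρ N (ExpKernelCalculus.shiftK ((N : ℤ) • t) K) = ExpKernelCalculus.shiftK ((N : ℤ) • t) (legCo₁At ρ N K) := by
  funext x y a b
  cases a with
  | inr m => rfl
  | inl α =>
    show coProjAt ρ N (fun α' x' => K (x' + (N : ℤ) • t) (y + (N : ℤ) • t) (Sum.inl α') b) α x =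
      coProjAt ρ N (fun α' x' => K x' (y + (N : ℤ) • t) (Sum.inl α') b) α (x + (N : ℤ) • t)
    exact coProjAt_shift ρ hN (fun α' x' => K x' (y + (N : ℤ) • t) (Sum.inl α') b) t α x

/-- [folklore] The second-leg rooted dressing commutes with simultaneous coarse shifts. -/
theorem legCo₂At_shiftK (ρ : Fin (d + 1) → ℤ) {N : ℕ} (hN : 1 ≤ N) (K : ExpKernelCalculus.MKer (d + 1) (Fib d))
    (t : Fin (d + 1) → ℤ) :
    legCo₂At ρ N (ExpKernelCalculus.shiftK ((N : ℤ) • t) K) = ExpKernelCalculus.shiftK ((N : ℤ) • t) (legCo₂At ρ N K) := by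
  funext x y a b
  cases b with
  | inr m => rfl
  | inl β =>
    show coProjAt ρ N (fun β' y' => K (x + (N : ℤ) • t) (y' + (N : ℤ) • t) a (Sum.inl β')) β y =
      coProjAt ρ N (fun β' y' => K (x + (N : ℤ) • t) y' a (Sum.inl β')) β (y + (N : ℤ) • t)
    exact coProjAt_shift ρ hN (fun β' y' => K (x + (N : ℤ) • t) y' a (Sum.inl β')) t β y

/-- [folklore] **THE ROOTED KERNEL DRESSING COMMUTES WITH COARSE SHIFTS.** -/
theorem dressKAt_shiftK (ρ : Fin (d + 1) → ℤ) {N : ℕ} (hN : 1 ≤ N) (K : ExpKernelCalculus.MKer (d + 1) (Fib d))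
    (t : Fin (d + 1) → ℤ) :
    dressKAt ρ N (ExpKernelCalculus.shiftK ((N : ℤ) • t) K) = ExpKernelCalculus.shiftK ((N : ℤ) • t) (dressKAt ρ N K) := by
  rw [dressKAt_eq, dressKAt_eq, legCo₁At_shiftK ρ hN, legCo₂At_shiftK ρ hN]

/-- [folklore] **THE `covS` SOCKET SURVIVES THE ROOTED DRESSING** (shape of `AxialDressing.dressS_translate` verbatim, so the
consumers' `…_S_translate` two-liners re-prove unchanged): if `S κ (u + N•t) = shiftK (−N•t) (S κ u)` then
`dressKAt ρ N (Πᵀ_ρ S κ u)` obeys the same law. -/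
theorem dressAtS_translate (ρ : Fin (d + 1) → ℤ) {N : ℕ} (hN : 1 ≤ N)
    {S : Fin (d + 1) → (Fin (d + 1) → ℤ) → ExpKernelCalculus.MKer (d + 1) (Fib d)}
    (hS : ∀ κ u t, S κ (u + (N : ℤ) • t) = ExpKernelCalculus.shiftK (-((N : ℤ) • t)) (S κ u))
    (κ : Fin (d + 1)) (u t : Fin (d + 1) → ℤ) :
    dressKAt ρ N (coProjAtK ρ N S κ (u + (N : ℤ) • t))
      = ExpKernelCalculus.shiftK (-((N : ℤ) • t)) (dressKAt ρ N (coProjAtK ρ N S κ u)) := by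
  have h1 : coProjAtK ρ N S κ (u + (N : ℤ) • t) = coProjAtK ρ N (fun κ' u' => S κ' (u' + (N : ℤ) • t)) κ u := by
    funext x y a b
    exact (coProjAt_shift ρ hN (fun κ' u' => S κ' u' x y a b) t κ u).symm
  have h2 : (fun κ' u' => S κ' (u' + (N : ℤ) • t)) = fun κ' u' => ExpKernelCalculus.shiftK (-((N : ℤ) • t)) (S κ' u') := by
    funext κ' u'
    exact hS κ' u' t
  rw [h1, h2, coProjAtK_shiftK, ← smul_neg, dressKAt_shiftK ρ hN]

/-- [folklore] **THE `covW` SOCKET SURVIVES THE ROOTED DRESSING** (shape of `AxialDressing.dressW_translate`). -/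
theorem dressAtW_translate (ρ : Fin (d + 1) → ℤ) {N : ℕ} (hN : 1 ≤ N)
    {W : Fin (d + 1) → (Fin (d + 1) → ℤ) → Fin (d + 1) → (Fin (d + 1) → ℤ) → ExpKernelCalculus.MKer (d + 1) (Fib d)}
    (hW : ∀ μ y ν y' t, W μ (y + t) ν (y' + t) = ExpKernelCalculus.shiftK (-((N : ℤ) • t)) (W μ y ν y'))
    (μ : Fin (d + 1)) (y : Fin (d + 1) → ℤ) (ν : Fin (d + 1)) (y' t : Fin (d + 1) → ℤ) :
    dressKAt ρ N (W μ (y + t) ν (y' + t)) = ExpKernelCalculus.shiftK (-((N : ℤ) • t)) (dressKAt ρ N (W μ y ν y')) := by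
  rw [hW, ← smul_neg, dressKAt_shiftK ρ hN]

end ShiftK

/-! ## §8 The rooted dressing functor `dressAt` on `JetData` -/

section Dress

/-- [folklore] `1 ≤ N` from `[NeZero N]`. -/
theorem one_le_of_neZero (N : ℕ) [NeZero N] : 1 ≤ N := Nat.one_le_iff_ne_zero.mpr (NeZero.ne N)

/-- [folklore] **THE ROOTED DRESSING FUNCTOR** `dressAt`: for an in-block root offset `r ∈ {0,…,N−1}^{d+1}` (root
`N•blk x + toSite r`; the centred choice is `r = AveragingContoursRooted.ctrOff (d+1) N`), `Πᵀ_ρ` on the stencil bond slot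
and on both `inl`-legs of every stencil value, `Πᵀ_ρ` on both `inl`-legs of every second-order table; same rate, constants
`cK²·cK'·Cs` and `cK²·Cw`.  Decl-by-decl twin of `AxialDressing.dress` (which is the CORNER root, a different comb). -/
noncomputable def dressAt {N : ℕ} [NeZero N] {r : Fin (d + 1) → ℕ} (hr : r ∈ box (d + 1) N) (J : JetData d N) :
    JetData d N where
  S := fun κ u => dressKAt (toSite r) N (coProjAtK (toSite r) N J.S κ u)
  W := fun μ y ν y' => dressKAt (toSite r) N (J.W μ y ν y')
  Cs := cK d N J.δ * (cK d N J.δ * (cK' d N J.δ * J.Cs))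
  Cw := cK d N J.δ * (cK d N J.δ * J.Cw)
  δ := J.δ
  δ_pos := J.δ_pos
  loc := locStencil_dressKAt (one_le_of_neZero N) hr
    (locStencil_coProjAtK (one_le_of_neZero N) hr J.loc J.δ_pos.le) J.δ_pos.le
  loc₂ := fun μ y ν y' => biLoc_dressKAt (one_le_of_neZero N) hr (J.loc₂ μ y ν y') J.δ_pos.le

/-- [folklore] The rooted-dressed stencil family, by definition. -/
theorem dressAt_S {N : ℕ} [NeZero N] {r : Fin (d + 1) → ℕ} (hr : r ∈ box (d + 1) N) (J : JetData d N)
    (κ : Fin (d + 1)) (u : Fin (d + 1) → ℤ) :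
    (dressAt hr J).S κ u = dressKAt (toSite r) N (coProjAtK (toSite r) N J.S κ u) := rfl

/-- [folklore] The rooted-dressed second-order family, by definition. -/
theorem dressAt_W {N : ℕ} [NeZero N] {r : Fin (d + 1) → ℕ} (hr : r ∈ box (d + 1) N) (J : JetData d N)
    (μ : Fin (d + 1)) (y : Fin (d + 1) → ℤ) (ν : Fin (d + 1)) (y' : Fin (d + 1) → ℤ) :
    (dressAt hr J).W μ y ν y' = dressKAt (toSite r) N (J.W μ y ν y') := rfl

/-- [folklore] The rooted dressing keeps the localisation rate. -/
theorem dressAt_δ {N : ℕ} [NeZero N] {r : Fin (d + 1) → ℕ} (hr : r ∈ box (d + 1) N) (J : JetData d N) :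
    (dressAt hr J).δ = J.δ := rfl

/-- [folklore] The constants of the rooted dressing, by definition. -/
theorem dressAt_Cs {N : ℕ} [NeZero N] {r : Fin (d + 1) → ℕ} (hr : r ∈ box (d + 1) N) (J : JetData d N) :
    (dressAt hr J).Cs = cK d N J.δ * (cK d N J.δ * (cK' d N J.δ * J.Cs)) := rfl

/-- [folklore] The constants of the rooted dressing, by definition. -/
theorem dressAt_Cw {N : ℕ} [NeZero N] {r : Fin (d + 1) → ℕ} (hr : r ∈ box (d + 1) N) (J : JetData d N) :
    (dressAt hr J).Cw = cK d N J.δ * (cK d N J.δ * J.Cw) := rfl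

/-- [folklore] **THE CENTRED DRESSING** (Bałaban's root: the block centre, `N` odd downstream): `dressCtr := dressAt` at
`r = ctrOff (d+1) N`. -/
noncomputable def dressCtr {N : ℕ} [NeZero N] (J : JetData d N) : JetData d N :=
  dressAt (ctrOff_mem_box (d := d + 1) (one_le_of_neZero N)) J

/-- [folklore] `dressCtr` unfolds to `dressAt` at the centre offset. -/
theorem dressCtr_eq {N : ℕ} [NeZero N] (J : JetData d N) :
    dressCtr J = dressAt (ctrOff_mem_box (d := d + 1) (one_le_of_neZero N)) J := rfl

end Dress

end Summit.QuantumFields.BalabanUV.Beta.AxialDressingRooted
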